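import Summits.BirchSwinnertonDyer.BirchSwinnertonDyer.Theses.PadicCornerSqueeze
import Summits.BirchSwinnertonDyer.BirchSwinnertonDyer.Theorems.LeadingTermPinchPrimeOrderEqRankOfSchneiderShaAt
import Summits.BirchSwinnertonDyer.BirchSwinnertonDyer.Theorems.LeadingTermPinchPrimeOpenStubsOfResidual
import Literature.NumberTheory.EllipticCurves.ModPIrreducibleCofinite
import Literature.NumberTheory.EllipticCurves.CanonicalPAdicHeightHolds

/-!
# Line `birth` (BC3 skeleton) for crux `PadicCornerSqueeze.PadicOrderLeRankAtOnePrime`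
# (stmt-BirchSwinnertonDyer-19213, route `route-BirchSwinnertonDyer-PadicCornerSqueeze`, crux rank 2)

Registered by the skeleton registrar `planner-skel-stmt-BirchSwinnertonDyer-19213-0` (2026-08-17).

## The crux (recall)

`PadicOrderLeRankAtOnePrime` (C2 of the card p-adic corner squeeze): for every elliptic `E/ℚ` on a
global minimal model `W` with `ord_{s=1} L(E,s) ≥ 2` there is ONE odd prime `p` of good ORDINARY
reduction such that for EVERY weight-2 newform `f` of `W`,
`ord_{T=0} L_p(f, α_p; T) ≤ rank_ℤ E(ℚ)` in `ℕ∞` (`α_p = unitRoot W p`,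
`L_p = padicLFunction f α_p`) — the "≤" half of the `p`-adic BSD rank conjecture at one prime.
Kato gives `ord_T L_p ≥ rank` always; the crux is the MISSING upper bound.

## The line: ALGEBRAIC SIDE AT ONE LARGE PRIME — main conjecture + Perrin-Riou–Schneider turn
## `ord_T L_p ≤ rank` at `p` into (Schneider non-degeneracy at `p`) ∧ (`Ш[p^∞]` finite), and the two
## open legs are cut so that they MEET at a common prime: `Ш`-leg COFINITE, height-leg INFINITELY OFTEN

At a good ordinary `p ≥ 5` with `E[p]` irreducible, `char_Λ X(E/ℚ_∞) = (L_p)` in `Λ ⊗ ℚ_p`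
(Burungale–Castella–Skinner 2025, Thm 1.1.2(a)), so `ord_T L_p = ord_T f_E`; and by
Perrin-Riou–Schneider (Schneider 1985; Balakrishnan–Müller–Stein 2016 Thm 1.7)
`ord_T f_E = rank ⟺ Reg_p(E) ≠ 0 ∧ #Ш(E/ℚ)[p^∞] < ∞`. Both are theorem-grade NAMED FACTS of the
tree, and their combination at one prime is the LANDED glue
`Cruxes.PinchPrime.FirstLayerStability.stub_orderEqRankOfSchneiderShaAt`
(`Theorems/LeadingTermPinchPrimeOrderEqRankOfSchneiderShaAt.lean`, p134300). Irreducibility of `E[p]`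
is free for `p ≫ 0` (`WeierstrassCurve.exists_forall_hasIrreducibleModPGaloisRep_of_lt`, AEC
Cor. IX.6.3 + `End_ℚ E = ℤ`, proved), the canonical height datum exists at every good ordinary
`p ≥ 5` (`exists_isCanonical_holds`, proved). What is OPEN is one prime carrying BOTH Schneider
non-degeneracy AND finiteness of `Ш[p^∞]`; two bare `∃ p` legs would not meet (barrier note B1 of the
PinchPrime line), so the cut is Infinite ∩ Cofinite. Three registered stubs:

* **F · `stub_theoremGradeFacts`** (KNOWN — two published theorems, formalisation debt, size XL
  each): the conjunction of the tree's undischarged named facts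
  `Schneider1985_order_charGenerator` (PRS: BMS 2016 Thm 1.7 ⇐ Schneider 1985, Perrin-Riou) and
  `burungale_castella_skinner_charIdeal_eq_padicLFunction` (cyclotomic IMC in `Λ ⊗ ℚ_p` under
  (irr_ℚ), `p > 3`: BCS 2025 Thm 1.1.2(a)). Exactly the two hypotheses of the landed G1 glue; no
  modularity conjunct is needed (the crux quantifies `∀ f`, vacuous without a newform).
* **A′ · `stub_cofiniteShaFinite_of_two_le_analyticRank`** (OPEN, `Ш`-leg, research): for every
  elliptic `W/ℚ` (globally minimal) with `r_an ≥ 2`, `Ш(E/ℚ)[p^∞]` is finite for all but finitely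
  many good ordinary `p`. VERBATIM the shared item `LeadingTerm.ShaFiniteCofiniteOfTwoLeAnalyticRank`
  (stmt-BirchSwinnertonDyer-17976, child A′ of `PinchPrime`); a range restriction of
  Tate–Shafarevich finiteness (`ShaFiniteConjecture`). Why it might fail: no Euler system beyond
  `r_an ≤ 1` (HeegnerPointBarrier); false iff some `r_an ≥ 2` curve has `Ш[p^∞]` infinite at
  infinitely many good ordinary `p`.
* **S · `stub_schneiderIO_of_two_le_analyticRank`** (OPEN, height-leg, research): for every elliptic
  `W/ℚ` (globally minimal) with `r_an ≥ 2` and every finite set `B` of primes there is a good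
  ordinary `p ≥ 5`, `p ∉ B`, at which every CANONICAL cyclotomic `p`-adic height datum is
  non-degenerate (`Reg_p(E, Dh) ≠ 0`, `SchneiderConjecture Dh`) — the `∃^∞ p` weakening of
  Mazur–Stein–Tate 2006 Conj. 1.1 on the crux's own range. It is the shared item
  `LeadingTerm.SchneiderInfinitelyOftenOfPosRank` (stmt-BirchSwinnertonDyer-17975, S′) restricted to
  `r_an ≥ 2`: `schneiderIO_of_two_le_analyticRank_of_posRank` below derives S from S′ and Bertrand's CM
  theorem through the landed `schneiderIO_of_residual` (rank `0`: `Reg_p = det ∅ = 1`,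
  `schneider_of_mordellWeilRank_eq_zero`; CM rank `1`: Bertrand 1984). Why it might fail: a curve
  whose regulator is `p`-adically degenerate at all but finitely many ordinary `p` is excluded by
  nothing proved (a `p`-adic Schanuel-type statement; elliptic Wieferich heuristics only bound the
  exceptional set's density).

`PadicOrderLeRankAtOnePrime_of` is sorry-free logic over PROVED tree results: for `W` with
`r_an ≥ 2`, A′ gives a finite `B` outside which `Ш[p^∞]` is finite at ordinary `p`;
`exists_forall_hasIrreducibleModPGaloisRep_of_lt` gives `N` beyond which `E[p]` is irreducible; S at
`B ∪ range (N+1)` gives a good ordinary `p ≥ 5` outside both with Schneider at the canonical datum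
(`exists_isCanonical_holds`); then G1 (fed by F) gives `ord_T L_p(f, α_p) = rank` for every newform
`f`, whence `≤`, and `p ≠ 2` from `p ≥ 5`. The same-prime waypoint is recorded as
`schneiderSha_somewhere_of_stubs` (A′ → S → ∃ one admissible prime with irreducible `E[p]`, finite
`Ш[p^∞]` and Schneider) and `padicOrderLeRankAtOnePrime_of_somewhere` (F + waypoint → crux).

Honest sizes: F known (XL+XL to formalise), A′ open (research), S open (research; the heart —
HARDEST, no engine produces non-degeneracy of a `p`-adic height in rank `≥ 2` at infinitely many `p`).

Disproof used: no `Disproof.lean` exists for this crux (`ledger crux ls stmt-BirchSwinnertonDyer-19213`: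
no workfiles before this one), so there is no `_false_without_<H>` obstruction to honour, no tightness
lemma, and no landed Negative lemma under `Theorems/PadicOrderLeRankAtOnePrime/Negative/`. Negatives
index of the summit (2026-08-17, 1 entry): `LeadingTerm.TamePinch` (stmt-15532, refuted-misstated by
`LeadingTermTamePinch_refuted`: the CM curve 32a2 has no `p ≥ 5` with SURJECTIVE `ρ̄_{E,p}`) — no stub
here asks surjectivity or any image condition: irreducibility of `E[p]` is not assumed but PROVED
cofinitely, and A′/S ask only good ordinary `p` (CM curves included: `infinite_goodOrdinaryPrimes_holds`).
`Theorems/PinchPrime/Negative/UniformPinchPrimeFalse.lean` (one `p` uniform in `W` is false) is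
respected: every prime here depends on `W`.

BC3 probes (planner folder `bc/probe_crux.lean`, `bc/probe_summit.lean`, `bc/probe_unfolded.lean`,
2026-08-17; each stub statement inlined VERBATIM — this file is NOT imported by the probes, so its
sorried stubs are invisible — one `example` per (stub, target, battery) under `maxHeartbeats 400000`,
same imports as this file; 18 examples, all three files rc 1 with exactly one error per `example`):
for each stub `X ∈ {F, A′, S}`, both `X → PadicOrderLeRankAtOnePrime` and `X → BirchSwinnertonDyer`
FAIL by (1) the literal battery `first | exact? | simpa | aesop` on the implication, (2) the same with
the hypothesis introduced (`simpa using h`), and (3) the BC2 battery with the target unfolded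
`first | exact? | simpa [T] using h | (unfold T; simpa using h) | aesop (add norm unfold T)` — every
time "unsolved goals" with `aesop: failed to prove the goal after exhaustive search` (battery 3 on the
crux: aesop introduces `W`, the instances and `2 ≤ W.analyticRank` and is left with the `∃ p` body; on
the summit it is left with `BSDRankConjecture`). No heartbeat timeouts. No stub is cheaply the crux or
the summit (F: two named facts with no proof in scope; A′, S: open statements about `Ш` / heights
with no tree theorem towards `ord_T L_p`). Verbatim outcomes: `Lines/birth.md`.
-/

set_option linter.unusedVariables false
set_option linter.dupNamespace false

noncomputable section

namespace Summit.BirchSwinnertonDyer.BirchSwinnertonDyer.Cruxes.PadicOrderLeRankAtOnePrime.Birth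

open scoped MatrixGroups ModularForm
open CongruenceSubgroup
open Summit.BirchSwinnertonDyer.BirchSwinnertonDyer.Theses.PadicCornerSqueeze
open Summit.BirchSwinnertonDyer.BirchSwinnertonDyer.Cruxes.PinchPrime.FirstLayerStability
  (stub_orderEqRankOfSchneiderShaAt schneiderIO_of_residual)
open Literature
open Literature.NumberTheory.EllipticCurves
open Literature.NumberTheory.EllipticCurves.ModularForms

/-! ## Registered stubs -/

/-- **F · `stub_theoremGradeFacts` — THE TWO THEOREM-GRADE NAMED FACTS OF THE LINE (KNOWN; XL each
to formalise).** Perrin-Riou–Schneider: order of vanishing / leading term of the characteristic power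
series of `X(E/ℚ_∞)` (`Schneider1985_order_charGenerator`, as printed in Balakrishnan–Müller–Stein
2016 Thm 1.7) AND the cyclotomic main conjecture `char_Λ X(E/ℚ_∞) = (L_p)` in `Λ ⊗ ℚ_p` for
`p > 3` good ordinary with `E[p]` irreducible (`burungale_castella_skinner_charIdeal_eq_padicLFunction`,
BCS 2025 Thm 1.1.2(a)). Published theorems not yet discharged in the tree; consumed as the two
hypotheses of the landed glue `stub_orderEqRankOfSchneiderShaAt`.
[cite: BalakrishnanMullerStein2015, Thm. 1.7] [cite: Schneider1985]
[cite: BurungaleCastellaSkinner2025, Thm. 1.1.2 (a)] -/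
theorem stub_theoremGradeFacts :
    Literature.NumberTheory.EllipticCurves.Schneider1985_order_charGenerator ∧
      Literature.NumberTheory.EllipticCurves.burungale_castella_skinner_charIdeal_eq_padicLFunction := by
  sorry

/-- **A′ · `stub_cofiniteShaFinite_of_two_le_analyticRank` — COFINITE `Ш`-FINITENESS IN ANALYTIC
RANK `≥ 2` (OPEN).** For every elliptic `W/ℚ` (globally minimal) with `ord_{s=1} L(W,s) ≥ 2`,
`Ш(W/ℚ)[p^∞]` is finite for all but finitely many good ordinary primes `p`. VERBATIM the shared item
`LeadingTerm.ShaFiniteCofiniteOfTwoLeAnalyticRank` (stmt-BirchSwinnertonDyer-17976). A range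
restriction of the Tate–Shafarevich conjecture; nothing is known for a single `r_an ≥ 2` curve at
cofinitely many `p` (Kolyvagin/Kato need a non-vanishing `L`-value or derivative).
[cite: Tate1974] [cite: Kolyvagin1990] [cite: Kato2004Asterisque, Thm 18.4] [cite: GreenbergLNM1716, §1] -/
theorem stub_cofiniteShaFinite_of_two_le_analyticRank :
    ∀ (W : WeierstrassCurve ℚ) [W.IsElliptic] [W.IsGloballyMinimal], 2 ≤ W.analyticRank →
      ∃ B : Finset ℕ, ∀ p ∉ B, ∀ [Fact p.Prime], Literature.NumberTheory.EllipticCurves.IsOrdinaryAt W p →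
        Finite (AddCommGroup.primaryComponent W.sha p) := by
  sorry

/-- **S · `stub_schneiderIO_of_two_le_analyticRank` — SCHNEIDER NON-DEGENERACY INFINITELY OFTEN IN
ANALYTIC RANK `≥ 2` (OPEN; the heart).** For every elliptic `W/ℚ` (globally minimal) with
`ord_{s=1} L(W,s) ≥ 2` and every finite set `B` there is a good ordinary prime `p ≥ 5`, `p ∉ B`, at
which every canonical cyclotomic `p`-adic height datum `Dh` is non-degenerate
(`SchneiderConjecture Dh : padicRegulator Dh ≠ 0`). The `∃^∞ p` weakening, on the crux's range, of
Mazur–Stein–Tate 2006 Conj. 1.1 (non-degeneracy at EVERY good ordinary `p`); = the shared item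
`LeadingTerm.SchneiderInfinitelyOftenOfPosRank` (stmt-BirchSwinnertonDyer-17975) restricted to
`r_an ≥ 2` (`schneiderIO_of_two_le_analyticRank_of_posRank`). Known sub-ranges: Mordell–Weil rank `0`
(`Reg_p = 1`, `schneider_of_mordellWeilRank_eq_zero`), CM of rank `1` (Bertrand 1984).
[cite: MazurSteinTate2006, Conj. 1.1 and §1] [cite: Schneider1985] [cite: Bertrand1984ThetaCM, §3 Cor. 1] -/
theorem stub_schneiderIO_of_two_le_analyticRank :
    ∀ (W : WeierstrassCurve ℚ) [W.IsElliptic] [W.IsGloballyMinimal], 2 ≤ W.analyticRank →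
      ∀ B : Finset ℕ, ∃ p ∉ B, ∃ _ : Fact p.Prime, 5 ≤ p ∧
        Literature.NumberTheory.EllipticCurves.IsOrdinaryAt W p ∧
        ∀ Dh : WeierstrassCurve.PAdicHeightData W p, Dh.IsCanonical →
          WeierstrassCurve.SchneiderConjecture Dh := by
  sorry

/-! ## Stub statements by name -/

namespace Statement

/-- Statement of `stub_theoremGradeFacts`. -/
abbrev stub_theoremGradeFacts : Prop := type_of% @Birth.stub_theoremGradeFacts
/-- Statement of `stub_cofiniteShaFinite_of_two_le_analyticRank`. -/
abbrev stub_cofiniteShaFinite_of_two_le_analyticRank : Prop :=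
  type_of% @Birth.stub_cofiniteShaFinite_of_two_le_analyticRank
/-- Statement of `stub_schneiderIO_of_two_le_analyticRank`. -/
abbrev stub_schneiderIO_of_two_le_analyticRank : Prop :=
  type_of% @Birth.stub_schneiderIO_of_two_le_analyticRank

end Statement

/-! ## The same-prime waypoint (sorry-free) -/

/-- **Infinite ∩ Cofinite.** From A′ and S: every `r_an ≥ 2` curve has ONE good ordinary prime
`p ≥ 5` carrying irreducible `E[p]` (cofinite: AEC Cor. IX.6.3, proved in the tree), finite
`Ш[p^∞]` (cofinite: A′) and Schneider non-degeneracy of the canonical height (infinitely often: S;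
the canonical datum exists by `exists_isCanonical_holds`). -/
theorem schneiderSha_somewhere_of_stubs
    (hA : Statement.stub_cofiniteShaFinite_of_two_le_analyticRank)
    (hS : Statement.stub_schneiderIO_of_two_le_analyticRank) :
    ∀ (W : WeierstrassCurve ℚ) [W.IsElliptic] [W.IsGloballyMinimal], 2 ≤ W.analyticRank →
      ∃ (p : ℕ) (_ : Fact p.Prime), 5 ≤ p ∧ IsOrdinaryAt W p ∧ W.HasIrreducibleModPGaloisRep p ∧
        Finite (AddCommGroup.primaryComponent W.sha p) ∧
        ∃ Dh : WeierstrassCurve.PAdicHeightData W p,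
          Dh.IsCanonical ∧ WeierstrassCurve.SchneiderConjecture Dh := by
  intro W _ _ hr
  obtain ⟨B, hB⟩ := hA W hr
  obtain ⟨N, hN⟩ := WeierstrassCurve.exists_forall_hasIrreducibleModPGaloisRep_of_lt W
  obtain ⟨p, hpB, hp, h5, hord, hSch⟩ := hS W hr (B ∪ Finset.range (N + 1))
  simp only [Finset.mem_union, Finset.mem_range, not_or, not_lt] at hpB
  obtain ⟨hpB₁, hNp⟩ := hpB
  have hirr : W.HasIrreducibleModPGaloisRep p := hN p (by omega) hp.out
  have hsha : Finite (AddCommGroup.primaryComponent W.sha p) := hB p hpB₁ hord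
  have hgood : W.HasGoodReductionAtPrime p := ((isOrdinaryAt_iff W p).1 hord).1
  have hnd : ¬ (p : ℤ) ∣ W.frobeniusTrace p := ((isOrdinaryAt_iff W p).1 hord).2
  obtain ⟨Dh, hDh⟩ := WeierstrassCurve.exists_isCanonical_holds W p h5 hgood hnd
  exact ⟨p, hp, h5, hord, hirr, hsha, Dh, hDh, hSch Dh hDh⟩

/-- **F + same prime ⟹ crux.** At the waypoint's prime the landed G1 glue
`stub_orderEqRankOfSchneiderShaAt` (PRS + BCS at one prime) gives `ord_T L_p(f, α_p) = rank` for
EVERY newform `f` of `W`; `≤` and `p ≠ 2` follow. -/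
theorem padicOrderLeRankAtOnePrime_of_somewhere
    (hPRS : Schneider1985_order_charGenerator)
    (hBCS : burungale_castella_skinner_charIdeal_eq_padicLFunction)
    (h : ∀ (W : WeierstrassCurve ℚ) [W.IsElliptic] [W.IsGloballyMinimal], 2 ≤ W.analyticRank →
      ∃ (p : ℕ) (_ : Fact p.Prime), 5 ≤ p ∧ IsOrdinaryAt W p ∧ W.HasIrreducibleModPGaloisRep p ∧
        Finite (AddCommGroup.primaryComponent W.sha p) ∧
        ∃ Dh : WeierstrassCurve.PAdicHeightData W p,
          Dh.IsCanonical ∧ WeierstrassCurve.SchneiderConjecture Dh) :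
    Summit.BirchSwinnertonDyer.BirchSwinnertonDyer.Theses.PadicCornerSqueeze.PadicOrderLeRankAtOnePrime := by
  intro W _ _ hr
  obtain ⟨p, hp, h5, hord, hirr, hsha, Dh, hDh, hSch⟩ := h W hr
  refine ⟨p, hp, by omega, hord, ?_⟩
  intro N _ f hf
  exact le_of_eq (stub_orderEqRankOfSchneiderShaAt hPRS hBCS W p h5 hord hirr hsha Dh hDh hSch f hf)

/-! ## The composition (sorry-free) -/

/-- **`PadicOrderLeRankAtOnePrime_of`** — the three registered stub STATEMENTS imply the crux, BY
NAME: F supplies PRS + BCS, A′ and S meet at one admissible prime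
(`schneiderSha_somewhere_of_stubs`), and `padicOrderLeRankAtOnePrime_of_somewhere` concludes. -/
theorem PadicOrderLeRankAtOnePrime_of (hF : Statement.stub_theoremGradeFacts)
    (hA : Statement.stub_cofiniteShaFinite_of_two_le_analyticRank)
    (hS : Statement.stub_schneiderIO_of_two_le_analyticRank) :
    Summit.BirchSwinnertonDyer.BirchSwinnertonDyer.Theses.PadicCornerSqueeze.PadicOrderLeRankAtOnePrime :=
  padicOrderLeRankAtOnePrime_of_somewhere hF.1 hF.2 (schneiderSha_somewhere_of_stubs hA hS)

/-- The crux along this line, MODULO the three registered stubs (sorries live only in `stub_*`). -/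
theorem PadicOrderLeRankAtOnePrime_proof :
    Summit.BirchSwinnertonDyer.BirchSwinnertonDyer.Theses.PadicCornerSqueeze.PadicOrderLeRankAtOnePrime :=
  PadicOrderLeRankAtOnePrime_of stub_theoremGradeFacts stub_cofiniteShaFinite_of_two_le_analyticRank
    stub_schneiderIO_of_two_le_analyticRank

/-! ## Sharing remark (sorry-free): S is the shared item S′ on the crux's range -/

/-- **S ⟸ S′ + Bertrand.** The shared open item `LeadingTerm.SchneiderInfinitelyOftenOfPosRank`
(stmt-BirchSwinnertonDyer-17975, verbatim the hypothesis `hS'`) together with Bertrand's CM theorem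
(`bertrand_pairing_self_ne_zero_of_hasCM`, theorem-grade named fact) gives S for EVERY curve, hence
on `r_an ≥ 2`, through the landed `schneiderIO_of_residual` (rank `0` and CM rank `1` are the known
ranges). So a proof of item 17975 closes stub S (modulo Bertrand). [cite: Bertrand1984ThetaCM, §3 Cor. 1] -/
theorem schneiderIO_of_two_le_analyticRank_of_posRank
    (hBer : bertrand_pairing_self_ne_zero_of_hasCM)
    (hS' : ∀ (W : WeierstrassCurve ℚ) [W.IsElliptic] [W.IsGloballyMinimal], 1 ≤ W.mordellWeilRank →
      (W.HasCM → 2 ≤ W.mordellWeilRank) → ∀ B : Finset ℕ, ∃ p ∉ B, ∃ _ : Fact p.Prime, 5 ≤ p ∧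
        Literature.NumberTheory.EllipticCurves.IsOrdinaryAt W p ∧
        ∀ Dh : WeierstrassCurve.PAdicHeightData W p, Dh.IsCanonical →
          WeierstrassCurve.SchneiderConjecture Dh) :
    Statement.stub_schneiderIO_of_two_le_analyticRank :=
  fun W _ _ _ B ↦ schneiderIO_of_residual hBer hS' W B

end Summit.BirchSwinnertonDyer.BirchSwinnertonDyer.Cruxes.PadicOrderLeRankAtOnePrime.Birth

end
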